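import Summits.BirchSwinnertonDyer.Rank1Residual.AdditivePotMult.PotMultChiBranchPrimePrep
import Literature.NumberTheory.EllipticCurves.Wuthrich2014.ReducibleDivisibilityCyclotomicPrimeHalf
import Literature.NumberTheory.EllipticCurves.Wuthrich2014.SurjectiveDivisibilityCyclotomicPrimeHalf
import HarnessLib

/-!
# [B∘C]@0 at EVERY odd `p` for a potentially MULTIPLICATIVE additive prime: the four typed `χ_p`-branch
# inputs `ChiBranchLeadingTerm[Odd][BigImage]At W p` are THEOREMS for every `W` with `ord_p j(W) < 0`,
# from the general-`p` componentwise readings over `ℚ(μ_{p^∞})` and the kernel transport [C]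
# (cell `b2b-bsdres`, seat additive-p1, gen 9 — "(M) brick 5′" of HOME/b2b-bsdres-additive-p1/KERNEL-C-P3.md §3)

HONEST FRAMING (cell `b2b-bsdres`, run/shared/lean/b2b/bsd-rank1-residual/, verbatim in every
file): the goal of the cell is to DELETE the COMBINATION-SHAPED residual classes of the
Birch–Swinnerton-Dyer formula for ALL analytic-rank `≤ 1` elliptic curves over `ℚ` — "full BSD
formula for every rank `≤ 1` curve in class `C`" assembled STRICTLY from published theorems — so
that the rank-`≤ 1` remainder becomes exactly the CONSTRUCTION-SHAPED classes, which are TYPED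
(missing-input `Prop`s), NOT attempted. This is not "finishing BSD". The additive sub-cell (seats
additive-p1…p4) is a RESEARCH ROUTE on the construction-shaped classes X3/X4; sub-cell additive-p1
= the potentially MULTIPLICATIVE additive prime (X3♯(M) / X4(M)); no claim beyond the stated
classes; the labels of X3/X4 are UNCHANGED by this file; nothing is booked.

Theorems only (pure compositions); no definition, no named fact minted. After `EigenLeadingTermThree.lean` (the `p = 3` case from A122/A123) this file
does EVERY odd `p` for the (M)-cells. Inputs: the two general-`p` componentwise READING-FACTS (lit
ruling C169, the last members of the Wuthrich-16 / Kato-17.4 family)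
`Wuthrich2014.thm16_halfEigenCharIdeal_dvd_cyclotomicPrime` (p235418: Thm. 16 at a semistable odd
`p`, `E[p]` reducible, component `m = (p−1)/2` over `ℚ(μ_{p^∞})`) and
`Wuthrich2014.kato_halfEigenCharIdeal_dvd_cyclotomicPrime_of_surjective` (p235488: Kato 17.4 (3) /
Thm. 3–Cor. 19, `ρ_{E,p^∞}` onto), stated for `D : V.EigenSelmerDualData p (ker κ ⊓ galRange K ⊓
galRange F) (ker κ) χ_K γ` with `K = ℚ(√p*)`, `F = ℚ(ζ_p)`, `γ ∈ Gal(ℚ̄/K) ⊓ Gal(ℚ̄/F)`. The kernel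
pieces: this seat's bricks 1–3 (`TwistDescent`, `ChiEigenSelmerDual`: `Sel(E/ℚ_∞) ≅
Sel(E♭/K·ℚ_∞)^{(χ_K)}`), additive-p2's gen-12 eigen-descent `ℚ(μ_{p^∞}) → K·ℚ_∞`
(`Additive/ChiEigenPrimeToPDescent{,Dual,Generator}`, packaged as
`SelmerDualData.exists_chiEigenInCyclotomic`: every `D : W.SelmerDualData κ γ` yields a normalised
generator `γ' ∈ Gal(ℚ̄/K) ⊓ Gal(ℚ̄/F)` and an `F`-level eigen datum with the SAME characteristic ideal /
torsion-ness), additive-p4's one-term-measure constant terms at `i = (p−1)/2`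
(`constantCoeff_padicLFunction[Plus|Minus]BranchMult_half[_of_[non]split]`, MTT §I.13–I.14).

* preparations (`PotMultChiBranchPrimePrep.lean`): `ChiEigenSelmerInDualData.toEigen` (additive-p2's
  `F`-level datum IS a Literature `EigenSelmerDualData`, `rfl` on the subgroup), the fields `ℚ(√p*)`
  / `ℚ(ζ_p)`, and the half branch of a `p`-multiplicative `V` with its `T = 0` value;
* §4 **the core transport `SelmerDualData.isTorsion_and_exists_constantCoeff_of_halfTail`**: from
  `D : W.SelmerDualData κ γ`, a twist model `C • V^{(p*)} = W` and the `F`-level componentwise input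
  for `V` to `X(W/ℚ_∞)` torsion ∧ `∃ g ∈ char, g(0) = u·ϖ·S`;
* §5 **`PotMult.chiBranchLeadingTermAt_of_halfFact`, `…OddAt…`, `…BigImageAt…`, `…OddBigImageAt…`**:
  for `PotMult W p` (additive, `ord_p j < 0`) every twist model `V` of `W^{(p*)}` is MULTIPLICATIVE at
  `p` (`PotMult.mult_of_twist_model_pStar`, gen 6), `V[p]` reducible iff `W[p]` is
  (`irr_iff_of_model_twist`), and §4 applies with the parity of `(p−1)/2` read off `p mod 4`.

CONSEQUENCE (next file `RankZeroChiBranchPrimeFacts.lean`): the gen-6/7 any-odd-`p` consumers fire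
class-wide — the rank-`0` UPPER HALF of `BSD(E,p)` for every X3♯(M) curve and every X4(M) ∧ surj(p)
curve at EVERY odd `p` from published theorems + kernel glue, `BSD(E,p)` on the `p ∤ #Ш_an` rows.
What is NOT here: the (G-ord) cells at `p ≥ 5` (additive-p2's brick 5′, same facts' good-ordinary
disjunct), the LOWER half (printed nowhere), ranks `≠ 0`. Labels UNCHANGED; nothing booked.

References: Wuthrich 2014 [Wuthrich2014] §3 p. 390, Thm. 16, Cor. 19; Kato 2004 [Kato2004Asterisque]
Thm. 17.4; Mazur–Tate–Teitelbaum 1986 [MazurTateTeitelbaum1986Invent] §I.10, §I.13–I.14; Greenberg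
LNM 1716 [GreenbergLNM1716] §5 p. 143.
-/

noncomputable section

open scoped Classical MatrixGroups ModularForm

namespace Summit.BirchSwinnertonDyer.Rank1Residual.AdditivePotMult

open CongruenceSubgroup WeierstrassCurve Literature.NumberTheory.EllipticCurves
  Literature.NumberTheory.EllipticCurves.ModularForms
  Literature.NumberTheory.EllipticCurves.Rank1Residual Literature.NumberTheory.GaloisRepresentations
  Additive Polynomial

/-! ## §4 The core transport: from a `Λ`-dual datum of `Sel(E/ℚ_∞)` to the `F`-level eigen datum and back -/

section Core

variable {p : ℕ} [hp : Fact p.Prime]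

omit hp in
/-- Parity bookkeeping: `p % 4 = 1 ⟹ Even (p/2)` and `p* = p`. [folklore] -/
theorem even_half_of_mod_four_eq_one (h : p % 4 = 1) :
    Even (p / 2) ∧ ((-1 : ℚ) ^ (p / 2) * p) = (p : ℚ) := by
  have he : Even (p / 2) := ⟨p / 4, by omega⟩
  exact ⟨he, by rw [he.neg_one_pow, one_mul]⟩

omit hp in
/-- Parity bookkeeping: `p % 4 = 3 ⟹ ¬ Even (p/2)` and `p* = −p`. [folklore] -/
theorem not_even_half_of_mod_four_eq_three (h : p % 4 = 3) :
    ¬ Even (p / 2) ∧ ((-1 : ℚ) ^ (p / 2) * p) = -(p : ℚ) := by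
  have ho : Odd (p / 2) := ⟨p / 4, by omega⟩
  exact ⟨Nat.not_even_iff_odd.mpr ho, by rw [ho.neg_one_pow, neg_one_mul]⟩

/-- **Core step (shared by all four variants).** Data: `p` odd, `c = p*`, a twist model
`C • V^{(c)} = W` with `V` multiplicative at `p`, `κ` cyclotomic with generator `γ` matching the
cyclotomic variable, and `D : W.SelmerDualData κ γ`. GIVEN the `F`-level componentwise input for `V`
(the common tail of the two facts, with the image hypothesis already discharged: for every quadratic
`K ∋ √c`, every `F = ℚ(ζ_p)`, every normalised generator `γ'` and every eigen datum), and a half branch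
`B` with `B(0) = e·S`: `X(W/ℚ_∞)` is torsion and some `g ∈ char` has `g(0) = u·ϖ·S`. Route: choose
`K = ℚ(√c)` (`exists_quadraticField_sq_eq`) and `F` (`exists_isCyclotomicExtension`); additive-p2's
`SelmerDualData.exists_chiEigenInCyclotomic` (= this seat's `toChiEigen` ∘ `toIn` ∘ generator
normalisation) gives `γ' ∈ Gal(ℚ̄/K) ⊓ Gal(ℚ̄/F)` and an `F`-level datum with the SAME `charIdeal` /
torsion-ness; `toEigen` (rfl); apply the input; read `T = 0`. [folklore] -/
theorem SelmerDualData.isTorsion_and_exists_constantCoeff_of_halfTail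
    {V W : WeierstrassCurve ℚ} [V.IsElliptic] [V.IsGloballyMinimal] {c : ℚ}
    [(V.quadraticTwist c).IsElliptic] [W.IsElliptic] {C : VariableChange ℚ}
    (hCW : C • V.quadraticTwist c = W) (hp2 : p ≠ 2) (hc : ∀ r : ℚ, r ^ 2 ≠ c)
    (hcp : ((-1 : ℚ) ^ (p / 2) * p) = c)
    {κ : ZpExtension ℚ p} (hκ : κ.IsCyclotomic) {γ : Field.absoluteGaloisGroup ℚ}
    (hγ : κ.IsTopGenerator γ) (hcyc : IsCyclotomicVariable p γ) (D : W.SelmerDualData κ γ)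
    {B : PowerSeries ℚ_[p]} {e : ℤ_[p]ˣ} {S ϖ : ℚ}
    (hB0 : PowerSeries.constantCoeff B = ((e : ℤ_[p]) : ℚ_[p]) * (S : ℚ_[p]))
    (htail : ∀ (K : Type) [Field K] [NumberField K] [(galRange (K := ℚ) K).Normal]
      (F : Type) [Field F] [NumberField F] [IsCyclotomicExtension {p} ℚ F]
      [(galRange (K := ℚ) F).Normal] {γ' : Field.absoluteGaloisGroup ℚ},
      Module.finrank ℚ K = 2 → (∃ θ : K, θ ^ 2 = algebraMap ℚ K ((-1) ^ (p / 2) * p)) →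
      κ.IsTopGenerator γ' → IsCyclotomicVariable p γ' →
      γ' ∈ galRange (K := ℚ) K → γ' ∈ galRange (K := ℚ) F →
      ∀ (D' : V.EigenSelmerDualData p
          (κ.kerSubgroup ⊓ galRange (K := ℚ) K ⊓ galRange (K := ℚ) F) κ.kerSubgroup
          (fun g ↦ if g ∈ galRange (K := ℚ) K then 1 else -1) γ'),
        Module.IsTorsion (IwasawaAlgebra p) D'.X ∧
        ∃ g ∈ D'.charIdeal, ∃ u : ℤ_[p]ˣ,
          iwasawaToPowerSeries p g = PowerSeries.C (((u : ℤ_[p]) : ℚ_[p]) * (ϖ : ℚ_[p])) * B) :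
    D.IsTorsion ∧ ∃ g ∈ D.charIdeal, ∃ u : ℤ_[p]ˣ,
      ((PowerSeries.constantCoeff g : ℤ_[p]) : ℚ_[p]) =
        ((u : ℤ_[p]) : ℚ_[p]) * (ϖ : ℚ_[p]) * (S : ℚ_[p]) := by
  -- the fields
  obtain ⟨K, _, _, h2, θ, hθ, hθ2⟩ := exists_quadraticField_sq_eq hc
  haveI : IsGalois ℚ K := isGalois_of_finrank_eq_two K h2
  haveI : (galRange (K := ℚ) K).Normal := RelModel.normal_galRange (K := ℚ) K
  obtain ⟨F, _, _, _⟩ := exists_isCyclotomicExtension p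
  haveI : (galRange (K := ℚ) F).Normal := normal_galRange_cyclotomic p F
  -- the `F`-level eigen datum with the same characteristic ideal
  obtain ⟨γ', hγ'KF, hκγ', ⟨g₀, hg₀, hγ'eq⟩, D', hchar, htor⟩ :=
    SelmerDualData.exists_chiEigenInCyclotomic p F V K h2 hθ hθ2 κ hCW hp2 D
  have hγ'top : κ.IsTopGenerator γ' := isTopGenerator_of_kappa_eq κ hκγ' hγ
  have hγ'cyc : IsCyclotomicVariable p γ' :=
    isCyclotomicVariable_of_eq_mul (p := p) (κ := κ) hκ hg₀ hγ'eq hcyc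
  obtain ⟨htor', g, hg, u, hu⟩ := htail K F h2 ⟨θ, by rw [hcp]; exact hθ2⟩ hγ'top hγ'cyc
    (Subgroup.mem_inf.mp hγ'KF).1 (Subgroup.mem_inf.mp hγ'KF).2
    (ChiEigenSelmerInDualData.toEigen V K κ _ γ' D')
  refine ⟨htor.mp htor', g, ?_, exists_unit_constantCoeff_of_eq_C_mul_prime p hu hB0⟩
  rw [← hchar]
  exact hg

end Core

/-! ## §5 The four typed `χ_p`-branch inputs for a potentially multiplicative `W`, at every odd `p` -/

section Inputs

variable {W : WeierstrassCurve ℚ} [W.IsElliptic] {p : ℕ} [hp : Fact p.Prime]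

/-- **`ChiBranchLeadingTermAt W p` (even branch, `p ≡ 1 (mod 4)`, reducible) for every `W` potentially
multiplicative at `p`**, from the componentwise Wuthrich reading at a multiplicative `p`
(`thm16_halfEigenCharIdeal_dvd_cyclotomicPrime`): every twist model `V` of `W^{(p)}` is
multiplicative at `p` (`PotMult.mult_of_twist_model_pStar`), `V[p]` is reducible iff `W[p]` is
(`irr_iff_of_model_twist`), and §4 does the transport. [folklore] -/
theorem PotMult.chiBranchLeadingTermAt_of_halfFact
    (hW16 : Wuthrich2014.thm16_halfEigenCharIdeal_dvd_cyclotomicPrime) (hpm : PotMult W p) :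
    ChiBranchLeadingTermAt W p := by
  intro V _ _ κ γ N _ f hp4 hCW hGM hred hκ hγ hcyc hf D ϖ hϖ
  obtain ⟨C, hCW'⟩ := hCW
  have hp2 : p ≠ 2 := by rintro rfl; norm_num at hp4
  obtain ⟨heven, hps⟩ := even_half_of_mod_four_eq_one hp4
  have hpQ : (p : ℚ) ≠ 0 := Nat.cast_ne_zero.mpr hp.out.ne_zero
  haveI : (V.quadraticTwist (p : ℚ)).IsElliptic := isElliptic_quadraticTwist V hpQ
  have hV : Mult V p := hpm.mult_of_twist_model_pStar hp2 V C (by rw [hps]; exact hCW')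
  have hredV : ¬ V.HasIrreducibleModPGaloisRep p := fun hirrV ↦
    hred ((irr_iff_of_model_twist (W := V) (p := p) hpQ ⟨C, hCW'⟩).mpr hirrV)
  obtain ⟨B, e, hdisj, hB0⟩ := exists_halfBranchMult_even p hp2 heven hV hf
  refine SelmerDualData.isTorsion_and_exists_constantCoeff_of_halfTail hCW' hp2
    (fun r hr ↦ not_sq_eq_pStar p r (by rw [hps]; exact hr)) hps hκ hγ hcyc D hB0 ?_
  intro K _ _ _ F _ _ _ _ γ' h2 hθ hγ' hcyc' hγ'K hγ'F D'
  exact hW16 p V K F B hp2 h2 hθ hdisj hredV hκ hγ' hcyc' hγ'K hγ'F hf D' ϖ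
    (by rw [if_pos heven]; exact hϖ)

/-- **`ChiBranchLeadingTermOddAt W p` (odd branch, `p ≡ 3 (mod 4)`, reducible) for every `W`
potentially multiplicative at `p`**, from `thm16_halfEigenCharIdeal_dvd_cyclotomicPrime`.
[folklore] -/
theorem PotMult.chiBranchLeadingTermOddAt_of_halfFact
    (hW16 : Wuthrich2014.thm16_halfEigenCharIdeal_dvd_cyclotomicPrime) (hpm : PotMult W p) :
    ChiBranchLeadingTermOddAt W p := by
  intro V _ _ κ γ N _ f hp4 hCW hGM hred hκ hγ hcyc hf D ϖ hϖ
  obtain ⟨C, hCW'⟩ := hCW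
  have hp2 : p ≠ 2 := by rintro rfl; norm_num at hp4
  obtain ⟨hodd, hps⟩ := not_even_half_of_mod_four_eq_three hp4
  have hpQ : (-(p : ℚ)) ≠ 0 := neg_ne_zero.mpr (Nat.cast_ne_zero.mpr hp.out.ne_zero)
  haveI : (V.quadraticTwist (-(p : ℚ))).IsElliptic := isElliptic_quadraticTwist V hpQ
  have hV : Mult V p := hpm.mult_of_twist_model_pStar hp2 V C (by rw [hps]; exact hCW')
  have hredV : ¬ V.HasIrreducibleModPGaloisRep p := fun hirrV ↦
    hred ((irr_iff_of_model_twist (W := V) (p := p) hpQ ⟨C, hCW'⟩).mpr hirrV)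
  obtain ⟨B, e, hdisj, hB0⟩ := exists_halfBranchMult_odd p hp2 hodd hV hf
  refine SelmerDualData.isTorsion_and_exists_constantCoeff_of_halfTail hCW' hp2
    (fun r hr ↦ not_sq_eq_pStar p r (by rw [hps]; exact hr)) hps hκ hγ hcyc D hB0 ?_
  intro K _ _ _ F _ _ _ _ γ' h2 hθ hγ' hcyc' hγ'K hγ'F D'
  exact hW16 p V K F B hp2 h2 hθ hdisj hredV hκ hγ' hcyc' hγ'K hγ'F hf D' ϖ
    (by rw [if_neg hodd]; exact hϖ)

/-- **`ChiBranchLeadingTermBigImageAt W p` (even branch, `p ≡ 1 (mod 4)`, `ρ_{E♭,p^∞}` onto) for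
every `W` potentially multiplicative at `p`**, from the componentwise Kato / Wuthrich-Cor-19 reading at
a multiplicative `p` (`kato_halfEigenCharIdeal_dvd_cyclotomicPrime_of_surjective`).
[folklore] -/
theorem PotMult.chiBranchLeadingTermBigImageAt_of_halfFact
    (hKato : Wuthrich2014.kato_halfEigenCharIdeal_dvd_cyclotomicPrime_of_surjective)
    (hpm : PotMult W p) : ChiBranchLeadingTermBigImageAt W p := by
  intro V _ _ κ γ N _ f hp4 hCW hGM hsurj hκ hγ hcyc hf D ϖ hϖ
  obtain ⟨C, hCW'⟩ := hCW
  have hp2 : p ≠ 2 := by rintro rfl; norm_num at hp4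
  obtain ⟨heven, hps⟩ := even_half_of_mod_four_eq_one hp4
  have hpQ : (p : ℚ) ≠ 0 := Nat.cast_ne_zero.mpr hp.out.ne_zero
  haveI : (V.quadraticTwist (p : ℚ)).IsElliptic := isElliptic_quadraticTwist V hpQ
  have hV : Mult V p := hpm.mult_of_twist_model_pStar hp2 V C (by rw [hps]; exact hCW')
  obtain ⟨B, e, hdisj, hB0⟩ := exists_halfBranchMult_even p hp2 heven hV hf
  refine SelmerDualData.isTorsion_and_exists_constantCoeff_of_halfTail hCW' hp2
    (fun r hr ↦ not_sq_eq_pStar p r (by rw [hps]; exact hr)) hps hκ hγ hcyc D hB0 ?_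
  intro K _ _ _ F _ _ _ _ γ' h2 hθ hγ' hcyc' hγ'K hγ'F D'
  exact hKato p V K F B hp2 h2 hθ hdisj hsurj hκ hγ' hcyc' hγ'K hγ'F hf D' ϖ
    (by rw [if_pos heven]; exact hϖ)

/-- **`ChiBranchLeadingTermOddBigImageAt W p` (odd branch, `p ≡ 3 (mod 4)`, `ρ_{E♭,p^∞}` onto) for
every `W` potentially multiplicative at `p`**, from
`kato_halfEigenCharIdeal_dvd_cyclotomicPrime_of_surjective`. [folklore] -/
theorem PotMult.chiBranchLeadingTermOddBigImageAt_of_halfFact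
    (hKato : Wuthrich2014.kato_halfEigenCharIdeal_dvd_cyclotomicPrime_of_surjective)
    (hpm : PotMult W p) : ChiBranchLeadingTermOddBigImageAt W p := by
  intro V _ _ κ γ N _ f hp4 hCW hGM hsurj hκ hγ hcyc hf D ϖ hϖ
  obtain ⟨C, hCW'⟩ := hCW
  have hp2 : p ≠ 2 := by rintro rfl; norm_num at hp4
  obtain ⟨hodd, hps⟩ := not_even_half_of_mod_four_eq_three hp4
  have hpQ : (-(p : ℚ)) ≠ 0 := neg_ne_zero.mpr (Nat.cast_ne_zero.mpr hp.out.ne_zero)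
  haveI : (V.quadraticTwist (-(p : ℚ))).IsElliptic := isElliptic_quadraticTwist V hpQ
  have hV : Mult V p := hpm.mult_of_twist_model_pStar hp2 V C (by rw [hps]; exact hCW')
  obtain ⟨B, e, hdisj, hB0⟩ := exists_halfBranchMult_odd p hp2 hodd hV hf
  refine SelmerDualData.isTorsion_and_exists_constantCoeff_of_halfTail hCW' hp2
    (fun r hr ↦ not_sq_eq_pStar p r (by rw [hps]; exact hr)) hps hκ hγ hcyc D hB0 ?_
  intro K _ _ _ F _ _ _ _ γ' h2 hθ hγ' hcyc' hγ'K hγ'F D'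
  exact hKato p V K F B hp2 h2 hθ hdisj hsurj hκ hγ' hcyc' hγ'K hγ'F hf D' ϖ
    (by rw [if_neg hodd]; exact hϖ)

end Inputs

end Summit.BirchSwinnertonDyer.Rank1Residual.AdditivePotMult

end
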